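/-
Copyright: lead seat `ym-line-sll-p1` (prover-ym-line-sll-p1-g0-0), route `SoftLoopLongLag`, crux `ColdBoxSoftLoopLagFloor`
(stmt-QuantumFields-22503), line `birth` (ingredient (i) of the load-bearing stub `stub_anharmonicRemainderG`), part 1 of 2.
-/
import Mathlib.Analysis.Matrix.Order
import Summits.QuantumFields.YangMills.Theorems.SoftLoopLongLagDefs
import Literature.Probability.LatticeModels.LatticeGreenHeatKernel
import Literature.Probability.FitznerVanDerHofstad2017.SrwLawBesselEGF

/-!
# Positive semidefinite kernels on `ℤ` and `ℤ³` from the continuous-time walk heat kernel (part 1 of 2 of the free-Maxwell lag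
# positivity for route `SoftLoopLongLag`; part 2 is `SoftLoopLongLagFreeMaxwellLagPositivity`)

WHAT.  (§1) A cosine transform `m ↦ ∫_{−π}^{π} cos(km) ω(k) dk` of a continuous non-negative weight is a positive semidefinite function on
`ℤ` (`Σ c_j c_{j'} cos(k(a_j − a_{j'})) = (Σ c_j cos(k a_j))² + (Σ c_j sin(k a_j))²`).  (§2) Hence the rate-one walk kernel
`q_t = srwHeatKernel t` and its negative second difference `f_t(m) = 2q_t(m) − q_t(m+1) − q_t(m−1)` (weights `e^{−t(1−cos k)}`,
`2(1−cos k)e^{−t(1−cos k)}`) are positive semidefinite.  (§3) Gram matrices and Schur's product theorem (Mathlib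
`Matrix.PosSemidef.hadamard`): the spatial kernel `K_t(y) = ½[f_t(y₁)q_t(y₂)q_t(y₃) + q_t(y₁)f_t(y₂)q_t(y₃)]` is positive semidefinite
along every finite family of sites (`sum_sum_mul_mul_spatialKernel_nonneg`).

WHY.  Part 2 writes the lag-`T` free lattice-Maxwell flux–flux kernel of `(1,2)`-plaquettes as `∫_0^∞ q_t(T) K_t dt` and concludes that the
lag-`T` autocovariance form of a smeared spatial flux is `≥ 0` — the sign of the background term in stub S2 of crux T′ (22503).

HONEST LABEL.  Elementary harmonic analysis serving a RECORD-label rung line (R2xi-G, leaf `WeakCouplingRates.XiPow` = an UPPER bound on the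
lattice mass gap); NOT the Clay mass gap; no summit statement is touched.

References: J. Fröhlich, R. Israel, E. H. Lieb, B. Simon, CMP 62 (1978) §3; I. Schur, J. reine angew. Math. 140 (1911).
-/

set_option autoImplicit false

noncomputable section

open MeasureTheory Real Finset
open Literature.Probability.LatticeModels (Site srwHeatKernel latticeGreen latticeGreen_eq_integral_prod_srwHeatKernel
  srwHeatKernel_neg)
open Literature.Probability.FitznerVanDerHofstad2017 (srwHeatKernel_nonneg)
open Literature.MathematicalPhysics.QuantumLattice (ZdPlaquette)
open Literature.MathematicalPhysics.QuantumFieldTheory (curvatureTwoPoint plaquetteBoundary plaquetteBoundarySign edgeGreen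
  edgeGreen_apply)

namespace Summit.QuantumFields.YangMills.Theorems.SoftLoopLongLag

/-- The `(1,2)` coordinate plane of `ℤ⁴` as a plaquette label (a named constant, so that all statements share one proof term). -/
def plane12 : {p : Fin 4 × Fin 4 // p.1 < p.2} := ⟨((1 : Fin 4), (2 : Fin 4)), by decide⟩

/-! ### §1. Cosine transforms of non-negative weights are positive semidefinite functions on `ℤ` -/

/-- `Σ_{j,j'} c_j c_{j'} cos(k(a_j − a_{j'})) = (Σ_j c_j cos(k a_j))² + (Σ_j c_j sin(k a_j))² ≥ 0`. -/
theorem sum_sum_mul_mul_cos_sub_nonneg {J : Type*} [Fintype J] (a : J → ℤ) (c : J → ℝ) (k : ℝ) :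
    0 ≤ ∑ j, ∑ j', c j * c j' * Real.cos (k * ((a j - a j' : ℤ) : ℝ)) := by
  have h : ∑ j, ∑ j', c j * c j' * Real.cos (k * ((a j - a j' : ℤ) : ℝ)) =
      (∑ j, c j * Real.cos (k * (a j : ℝ))) ^ 2 + (∑ j, c j * Real.sin (k * (a j : ℝ))) ^ 2 := by
    simp only [sq, Finset.sum_mul, Finset.mul_sum, ← Finset.sum_add_distrib]
    refine Finset.sum_congr rfl fun j _ => Finset.sum_congr rfl fun j' _ => ?_
    rw [Int.cast_sub, mul_sub, Real.cos_sub]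
    ring
  rw [h]
  positivity

/-- A cosine transform `m ↦ ∫_{−π}^{π} cos(k m) ω(k) dk` of a continuous non-negative weight `ω` is a positive semidefinite function on
`ℤ`: `0 ≤ Σ_{j,j'} c_j c_{j'} ∫ cos(k(a_j − a_{j'})) ω(k) dk`. -/
theorem sum_sum_mul_mul_cosTransform_nonneg {J : Type*} [Fintype J] (ω : ℝ → ℝ) (hω : Continuous ω) (hω0 : ∀ k, 0 ≤ ω k)
    (a : J → ℤ) (c : J → ℝ) :
    0 ≤ ∑ j, ∑ j', c j * c j' * ∫ k in (-π)..π, Real.cos (k * ((a j - a j' : ℤ) : ℝ)) * ω k := by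
  -- every summand `k ↦ c_j c_{j'} (cos(k m) ω(k))` is continuous, hence interval integrable
  have hcont : ∀ (m : ℤ) (r : ℝ), Continuous fun k : ℝ => r * (Real.cos (k * (m : ℝ)) * ω k) := fun m r =>
    continuous_const.mul ((Real.continuous_cos.comp (continuous_id.mul continuous_const)).mul hω)
  have hint : ∀ (m : ℤ) (r : ℝ), IntervalIntegrable (fun k : ℝ => r * (Real.cos (k * (m : ℝ)) * ω k)) volume (-π) π :=
    fun m r => (hcont m r).intervalIntegrable _ _
  have hswap : ∑ j, ∑ j', c j * c j' * ∫ k in (-π)..π, Real.cos (k * ((a j - a j' : ℤ) : ℝ)) * ω k =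
      ∫ k in (-π)..π, ∑ j, ∑ j', c j * c j' * (Real.cos (k * ((a j - a j' : ℤ) : ℝ)) * ω k) := by
    rw [intervalIntegral.integral_finsetSum (fun j _ => ?_)]
    · refine Finset.sum_congr rfl fun j _ => ?_
      rw [intervalIntegral.integral_finsetSum (fun j' _ => hint _ _)]
      refine Finset.sum_congr rfl fun j' _ => ?_
      rw [intervalIntegral.integral_const_mul]
    · exact (continuous_finsetSum _ fun j' _ => hcont _ _).intervalIntegrable _ _
  rw [hswap]
  refine intervalIntegral.integral_nonneg (by linarith [Real.pi_pos]) fun k _ => ?_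
  have h := mul_nonneg (sum_sum_mul_mul_cos_sub_nonneg a c k) (hω0 k)
  rw [Finset.sum_mul] at h
  refine h.trans_eq (Finset.sum_congr rfl fun j _ => ?_)
  rw [Finset.sum_mul]
  exact Finset.sum_congr rfl fun j' _ => by ring

/-! ### §2. The walk kernel `q_t` and its negative second difference `f_t` are positive semidefinite on `ℤ` -/

/-- The negative second difference `f_t(m) = 2q_t(m) − q_t(m+1) − q_t(m−1)` of the continuous-time walk kernel on `ℤ`. -/
def srwHeatKernelNegLap (t : ℝ) (m : ℤ) : ℝ :=
  2 * srwHeatKernel t m - srwHeatKernel t (m + 1) - srwHeatKernel t (m - 1)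

/-- `q_t(m) = ∫_{−π}^{π} cos(k m) · (2π)⁻¹ e^{−t(1−cos k)} dk` (the definition, with the normalisation moved inside). -/
theorem srwHeatKernel_eq_cosTransform (t : ℝ) (m : ℤ) :
    srwHeatKernel t m = ∫ k in (-π)..π, Real.cos (k * (m : ℝ)) * ((2 * π)⁻¹ * Real.exp (-(t * (1 - Real.cos k)))) := by
  rw [srwHeatKernel, div_eq_inv_mul, ← intervalIntegral.integral_const_mul]
  refine intervalIntegral.integral_congr fun k _ => ?_
  ring

/-- `f_t(m) = ∫_{−π}^{π} cos(k m) · (2π)⁻¹ 2(1 − cos k) e^{−t(1−cos k)} dk` (`cos(k(m+1)) + cos(k(m−1)) = 2 cos(km) cos k`). -/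
theorem srwHeatKernelNegLap_eq_cosTransform (t : ℝ) (m : ℤ) :
    srwHeatKernelNegLap t m =
      ∫ k in (-π)..π, Real.cos (k * (m : ℝ)) * ((2 * π)⁻¹ * (2 * (1 - Real.cos k) * Real.exp (-(t * (1 - Real.cos k))))) := by
  have hc : ∀ m' : ℤ, Continuous fun k : ℝ => Real.cos (k * (m' : ℝ)) * ((2 * π)⁻¹ * Real.exp (-(t * (1 - Real.cos k)))) :=
    fun m' => by fun_prop
  have hi : ∀ m' : ℤ, IntervalIntegrable
      (fun k : ℝ => Real.cos (k * (m' : ℝ)) * ((2 * π)⁻¹ * Real.exp (-(t * (1 - Real.cos k))))) volume (-π) π :=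
    fun m' => (hc m').intervalIntegrable _ _
  rw [srwHeatKernelNegLap, srwHeatKernel_eq_cosTransform, srwHeatKernel_eq_cosTransform, srwHeatKernel_eq_cosTransform,
    ← intervalIntegral.integral_const_mul, ← intervalIntegral.integral_sub ((hi m).const_mul 2) (hi _),
    ← intervalIntegral.integral_sub (((hi m).const_mul 2).sub (hi _)) (hi _)]
  refine intervalIntegral.integral_congr fun k _ => ?_
  have h1 : Real.cos (k * ((m + 1 : ℤ) : ℝ)) = Real.cos (k * m) * Real.cos k - Real.sin (k * m) * Real.sin k := by
    rw [Int.cast_add, Int.cast_one, mul_add, mul_one, Real.cos_add]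
  have h2 : Real.cos (k * ((m - 1 : ℤ) : ℝ)) = Real.cos (k * m) * Real.cos k + Real.sin (k * m) * Real.sin k := by
    rw [Int.cast_sub, Int.cast_one, mul_sub, mul_one, Real.cos_sub]
  simp only [h1, h2]
  ring

/-- `q_t` is a positive semidefinite function on `ℤ`. -/
theorem sum_sum_mul_mul_srwHeatKernel_nonneg {J : Type*} [Fintype J] (t : ℝ) (a : J → ℤ) (c : J → ℝ) :
    0 ≤ ∑ j, ∑ j', c j * c j' * srwHeatKernel t (a j - a j') := by
  simp_rw [srwHeatKernel_eq_cosTransform]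
  exact sum_sum_mul_mul_cosTransform_nonneg _ (by fun_prop) (fun k => by positivity) a c

/-- `f_t` is a positive semidefinite function on `ℤ`. -/
theorem sum_sum_mul_mul_srwHeatKernelNegLap_nonneg {J : Type*} [Fintype J] (t : ℝ) (a : J → ℤ) (c : J → ℝ) :
    0 ≤ ∑ j, ∑ j', c j * c j' * srwHeatKernelNegLap t (a j - a j') := by
  simp_rw [srwHeatKernelNegLap_eq_cosTransform]
  refine sum_sum_mul_mul_cosTransform_nonneg _ (by fun_prop) (fun k => ?_) a c
  have : 0 ≤ 1 - Real.cos k := by linarith [Real.cos_le_one k]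
  positivity

/-! ### §3. Gram matrices and Schur's product theorem over the three spatial coordinates -/

section Gram

variable {J : Type*} [Fintype J]

/-- The Gram matrix of a symmetric function `φ` on `ℤ` along an integer family `a`: `(j, j') ↦ φ(a_j − a_{j'})`. -/
def gram (φ : ℤ → ℝ) (a : J → ℤ) : Matrix J J ℝ := fun j j' => φ (a j - a j')

omit [Fintype J] in
/-- `gram φ a` is Hermitian (symmetric) when `φ` is even. -/
theorem isHermitian_gram {φ : ℤ → ℝ} (hφ : ∀ m, φ (-m) = φ m) (a : J → ℤ) : (gram φ a).IsHermitian := by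
  refine Matrix.IsHermitian.ext fun i j => ?_
  simp only [gram, star_trivial]
  rw [← hφ, neg_sub]

/-- A Gram matrix is positive semidefinite when the double sums `Σ c_j c_{j'} φ(a_j − a_{j'})` are non-negative and `φ` is even. -/
theorem posSemidef_gram {φ : ℤ → ℝ} (hφ : ∀ m, φ (-m) = φ m) (a : J → ℤ)
    (hpos : ∀ c : J → ℝ, 0 ≤ ∑ j, ∑ j', c j * c j' * φ (a j - a j')) : (gram φ a).PosSemidef := by
  refine Matrix.PosSemidef.of_dotProduct_mulVec_nonneg (isHermitian_gram hφ a) fun x => ?_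
  have h := hpos x
  refine h.trans_eq ?_
  simp only [dotProduct, Matrix.mulVec, Pi.star_apply, star_trivial, Finset.mul_sum, gram]
  exact Finset.sum_congr rfl fun j _ => Finset.sum_congr rfl fun j' _ => by ring

/-- From a positive semidefinite real matrix back to the double-sum inequality. -/
theorem sum_sum_mul_mul_nonneg_of_posSemidef {M : Matrix J J ℝ} (hM : M.PosSemidef) (c : J → ℝ) :
    0 ≤ ∑ j, ∑ j', c j * c j' * M j j' := by
  have h := hM.dotProduct_mulVec_nonneg c
  refine h.trans_eq ?_
  simp only [dotProduct, Matrix.mulVec, Pi.star_apply, star_trivial, Finset.mul_sum]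
  exact Finset.sum_congr rfl fun j _ => Finset.sum_congr rfl fun j' _ => by ring

/-- `f_t` is even. -/
theorem srwHeatKernelNegLap_neg (t : ℝ) (m : ℤ) : srwHeatKernelNegLap t (-m) = srwHeatKernelNegLap t m := by
  simp only [srwHeatKernelNegLap]
  rw [show -m + 1 = -(m - 1) by ring, show -m - 1 = -(m + 1) by ring, srwHeatKernel_neg, srwHeatKernel_neg, srwHeatKernel_neg]
  ring

/-- The spatial lag kernel at heat-time `t`,
`K_t(y) = ½ [f_t(y₁) q_t(y₂) q_t(y₃) + q_t(y₁) f_t(y₂) q_t(y₃)]`, is positive semidefinite along every family of time-zero sites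
(Schur products of the positive semidefinite Gram matrices of `q_t`, `f_t` in the coordinates `1, 2, 3`). -/
theorem sum_sum_mul_mul_spatialKernel_nonneg (t : ℝ) (g : J → Site 4) (c : J → ℝ) :
    0 ≤ ∑ j, ∑ j', c j * c j' *
      ((srwHeatKernelNegLap t (g j 1 - g j' 1) * srwHeatKernel t (g j 2 - g j' 2) * srwHeatKernel t (g j 3 - g j' 3) +
        srwHeatKernel t (g j 1 - g j' 1) * srwHeatKernelNegLap t (g j 2 - g j' 2) * srwHeatKernel t (g j 3 - g j' 3)) / 2) := by
  have hq : ∀ i : Fin 4, (gram (srwHeatKernel t) (fun j => g j i)).PosSemidef := fun i =>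
    posSemidef_gram (srwHeatKernel_neg t) _ (sum_sum_mul_mul_srwHeatKernel_nonneg t _)
  have hf : ∀ i : Fin 4, (gram (srwHeatKernelNegLap t) (fun j => g j i)).PosSemidef := fun i =>
    posSemidef_gram (srwHeatKernelNegLap_neg t) _ (sum_sum_mul_mul_srwHeatKernelNegLap_nonneg t _)
  have h1 := sum_sum_mul_mul_nonneg_of_posSemidef (((hf 1).hadamard (hq 2)).hadamard (hq 3)) c
  have h2 := sum_sum_mul_mul_nonneg_of_posSemidef (((hq 1).hadamard (hf 2)).hadamard (hq 3)) c
  have hsum := add_nonneg h1 h2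
  rw [← Finset.sum_add_distrib] at hsum
  have key : ∑ j, ∑ j', c j * c j' *
      ((srwHeatKernelNegLap t (g j 1 - g j' 1) * srwHeatKernel t (g j 2 - g j' 2) * srwHeatKernel t (g j 3 - g j' 3) +
        srwHeatKernel t (g j 1 - g j' 1) * srwHeatKernelNegLap t (g j 2 - g j' 2) * srwHeatKernel t (g j 3 - g j' 3)) / 2) =
      (∑ j, (∑ j', c j * c j' * ((gram (srwHeatKernelNegLap t) (fun j => g j 1)).hadamard (gram (srwHeatKernel t) fun j => g j 2)
            |>.hadamard (gram (srwHeatKernel t) fun j => g j 3)) j j' +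
          ∑ j', c j * c j' * ((gram (srwHeatKernel t) (fun j => g j 1)).hadamard (gram (srwHeatKernelNegLap t) fun j => g j 2)
            |>.hadamard (gram (srwHeatKernel t) fun j => g j 3)) j j')) / 2 := by
    rw [Finset.sum_div]
    refine Finset.sum_congr rfl fun j _ => ?_
    rw [← Finset.sum_add_distrib, Finset.sum_div]
    refine Finset.sum_congr rfl fun j' _ => ?_
    simp only [Matrix.hadamard_apply, gram]
    ring
  rw [key]
  exact div_nonneg hsum zero_le_two

end Gram

end Summit.QuantumFields.YangMills.Theorems.SoftLoopLongLag

end
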